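import Summits.BirchSwinnertonDyer.BirchSwinnertonDyer.Theorems.ByReductionTypeAtTwoSupersingularFlatKummerInjection
import Summits.BirchSwinnertonDyer.BirchSwinnertonDyer.Theorems.ByReductionTypeAtTwoSupersingularFlatColemanLinearOfTraces
import Literature.NumberTheory.EllipticCurves.Sprung2012.FineSelmerLeSharpFlatSelmerProofs
import HarnessLib

/-!
# Route `ByReductionTypeAtTwo` (rung K4), crux `SupersingularRankZeroAtTwo` (item stmt-BirchSwinnertonDyer-19097), line
# `odd_blind_package` v2.16, stub 3/6 `stub_flatPackage`, conjunct (8), clause F1♭ — **THE ♭ LOCAL DUALITY MAP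
# `ν : H¹_Iw(K_v, T) → X♭` IN THE TREE'S POINTS MODEL, ITS VALUES, ITS KERNEL (`Ker Col♭`), ITS VANISHING ON `Sel₀`, AND ITS
# VARIANCE `(1+X) • ν((1+T) • w) = ν w`** (any number field `K`, prime `p`, `ℤ_p`-extension, place `v`, generator pair `(γ, g)`;
# cell `bsd-2adic`, seat `bsd-2adic-tower-1` GEN 67, hand H2-F1F3 — the `toX` core of the displayed-witness contract;
# `--supports 19097`, helper)

HONEST FRAMING (D-0054): THEOREMS ONLY — no definition, no named fact, no instance, no `sorry`.

## What and why

Conjunct (8) of `FlatPackageAtTwo` asks for `toX : P →ₗ[Λ] D.X` with `Function.Exact loc toX ∧ Function.Exact toX δ`, `D` a pinned dual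
`X♭ = Hom(Sel♭(E/K_∞), ℚ/ℤ)` of Sprung's ♭-Selmer group.  In the tree's transcription `H¹_Iw(K_v, T_pE)` = functionals
`w : E(K_∞·K_v) →+ ℤ_p` and the local Tate pairing of a Kummer class `[x ⊗ p^{-k}]` with `w` is `w(x)/p^k mod ℤ` (Kummer pairing character
`Φ`, `OddBlindNF.exists_kummerPairingHom`).  The PRINT map `H¹_Iw(K_v,T)/H¹_♭ → X♭` (Kobayashi (7.17)–(7.21) / Sprung (3), Prop. 7.19) is
therefore `ν : w ↦ [s ↦ Φ(res_v s)(w)]`.  This file constructs `ν` as an ADDITIVE map into the pinned `D.X` and proves the four facts every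
version of F1♭ consumes: (V) its values on Kummer data; (K) it kills `Ker Col♭` (so it descends to `Λ ≅ H¹_Iw/Ker Col♭` along any Λ-linear
♭ Coleman map — `SSFlatEC.exists_linearMap_isColemanPair_of_traces`, `flat_surjective_rat`); (Z) `ν w` kills `Sel₀(K_∞, E[p^∞])` (so
`range ν ⊆ ker δ` for the transpose `δ : X♭ ↠ X₀` of `Sprung2012.SharpFlatSelmerDualData.exists_linearMap_toFineDual`); (T) its VARIANCE
under the two `Λ`-structures — `Sprung2012.moduleOfGenerator` on functionals (`1+T ↔ Θ_g`, `(Θ_g w)(y) = w(g⁻¹y)`) and `D.toDual_T_smul` on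
`X♭` (`1+X ↔` pre-composition with `conj_γ`): **`(1 + X) • ν ((1 + T) • w) = ν w`**, i.e. `ν` is `ι`-SEMILINEAR for `ι : T ↦ (1+T)⁻¹ − 1`, NOT
`Λ`-linear — the Kummer pairing is contragredient (`OddBlindNF.kummerCharacter_conjH1_resGalOfEmb_apply`; K2's ordinary fact records the same
adjointness as its clause (T)).  Consequence for (8): see memo `HOME/tower/gen67/F3-ERL-flat-at-2.md` §4 (linear witnesses exist but move
an `ι`-symmetry demand into F3a ∧ ZL2).  Closes NO stub; 19097 OPEN; nothing booked; BSD is proved for no curve; typed ≠ proved.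

## What is proved
* `sharpFlatSelmerInfty_le_localKummerOverOfEmb` — every `s ∈ Sel♭` has a Kummer datum at `v`.
* `smul_one_add_X_apply_smul_point` — `((1+T) • w)(g • y) = w y`.
* ★ `exists_flatLocalDualityHom` — `∃ ν : (E(K_∞·K_v) →+ ℤ_p) →+ D.X` with (V), (K), (Z), (T).

References: [Kobayashi2003] (7.17)–(7.21) (p. 12), §2 p. 4, (8.23); [Sprung2012] Def. 7.9, Lemma 7.10, Def. 7.11 (p. 1503), Thm. 7.14 (3),
Prop. 7.19 (pp. 1504–1505); [GreenbergLNM1716] §1 p. 60, §4 (8) p. 121; [PerrinRiou1994Invent] §3.6.1; [KitajimaOtsuki2018] (4.2), Prop. 3.32.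
-/

set_option autoImplicit false
-- the Theorems namespace of this sub repeats the summit name by design (D-0017 nested layout)
set_option linter.dupNamespace false

noncomputable section

open scoped Classical NumberField

universe u

namespace Summit.BirchSwinnertonDyer.BirchSwinnertonDyer.Theorems

namespace SSFlatPackage

open NumberField IsDedekindDomain Field WeierstrassCurve Literature.NumberTheory.EllipticCurves
  Literature.NumberTheory.EllipticCurves.Sprung2012 Literature.NumberTheory.EllipticCurves.Sprung2017
  Literature.NumberTheory.EllipticCurves.Kobayashi2003 Literature.NumberTheory.EllipticCurves.IwasawaDual
  Literature.NumberTheory.EllipticCurves.GreenbergSelmer Literature.NumberTheory.GaloisRepresentations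
  Literature.Algebra.Module ZpExtension

variable {K : Type u} [Field K] [NumberField K] (W : WeierstrassCurve K) {p : ℕ} [hp : Fact p.Prime]
  (κ : ZpExtension K p) {γ : absoluteGaloisGroup K} (v : HeightOneSpectrum (𝓞 K)) {ap : ℤ}
  {g : absoluteGaloisGroup (v.adicCompletion K)} {c : ℕ → localPoints W (v.adicCompletion K)}

/-- **Every class of `Sel♭(E/K_∞)` has a Kummer datum at `v`** (`Sel♭ ≤ Sel_{p^∞}(E/K_∞) ≤` the Kummer classes of `E(K_∞·K_v)`,
`OddBlindNF.selmerInfty_le_localKummerOverOfEmb`). [cite: Sprung2012, Def. 7.11 and Lemma 7.10 (p. 1503)] -/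
theorem sharpFlatSelmerInfty_le_localKummerOverOfEmb (col : Chroma) :
    sharpFlatSelmerInfty W κ (closureEmb (K := K) (v.adicCompletion K)) ap g c col ≤
      localKummerOverOfEmb W p κ.kerSubgroup (closureEmb (K := K) (v.adicCompletion K))
        (localTowerPointsOfEmb κ (closureEmb (K := K) (v.adicCompletion K)) W) :=
  (sharpFlatSelmerInfty_le_selmerInfty W κ _ ap g c col).trans (OddBlindNF.selmerInfty_le_localKummerOverOfEmb W κ v)

/-- **`((1+T) • w)(g • y) = w y`**: `1+T` acts as `Θ_g = (· ∘ g⁻¹)` on functionals (`Sprung2012.lambdaSMul_X_apply`).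
[cite: Sprung2012, §2 p. 1486 (γ ↦ 1+T) and Def. 3.1 (p. 1489)] -/
theorem smul_one_add_X_apply_smul_point (hg : κ.IsTopGenerator (resGalOfEmb (closureEmb (K := K) (v.adicCompletion K)) g))
    (w : localTowerPointsOfEmb κ (closureEmb (K := K) (v.adicCompletion K)) W →+ ℤ_[p])
    (y : localTowerPointsOfEmb κ (closureEmb (K := K) (v.adicCompletion K)) W) :
    (letI := moduleOfGenerator κ (closureEmb (K := K) (v.adicCompletion K)) W hg;
      ((1 + PowerSeries.X : IwasawaAlgebra p) • w)
        ⟨g • (y : localPoints W (v.adicCompletion K)),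
          smul_mem_localTowerPointsOfEmb κ (closureEmb (K := K) (v.adicCompletion K)) W g y.2⟩) = w y := by
  letI := moduleOfGenerator κ (closureEmb (K := K) (v.adicCompletion K)) W hg
  have hy : (⟨g⁻¹ • (g • (y : localPoints W (v.adicCompletion K))),
      smul_mem_localTowerPointsOfEmb κ (closureEmb (K := K) (v.adicCompletion K)) W g⁻¹
        (smul_mem_localTowerPointsOfEmb κ (closureEmb (K := K) (v.adicCompletion K)) W g y.2)⟩ :
      localTowerPointsOfEmb κ (closureEmb (K := K) (v.adicCompletion K)) W) = y :=
    Subtype.ext (inv_smul_smul g (y : localPoints W (v.adicCompletion K)))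
  rw [add_smul, one_smul, AddMonoidHom.add_apply, moduleOfGenerator_smul_eq, lambdaSMul_X_apply, hy, add_sub_cancel]

/-- ★ **The ♭ local duality map `ν : H¹_Iw(K_v, T_pE) → X♭(E/K_∞)` and its four properties.**  For a topological generator `γ`
(`κ γ = 1`), a local `g` with `κ(res g) = 1`, `p ∣ a_p`, data `c`, any ♭ Coleman family `J` (`Col(z) = (Js z, (J z).2)` for all `z`)
and any pinned ♭ dual datum `D`: there is an ADDITIVE `ν : (E(K_∞·K_v) →+ ℤ_p) →+ D.X` with
(V) `D.toDual (ν w) s = w(p^kQ)/p^k mod ℤ` for every Kummer datum `(φ, Q, k)` of `s ∈ Sel♭` at `v`;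
(K) `(J w).2 = 0 → ν w = 0` (`Ker Col♭ ⊆ ker ν`: the ♭-condition says exactly that `Φ(s)` kills `Ker Col♭`);
(Z) `ν w` kills `Sel₀(K_∞, E[p^∞])` (a fine class is principal on `ker κ ⊓ D_v`, so it has a TORSION Kummer point);
(T) `(1 + X) • ν ((1 + T) • w) = ν w` — `ν` intertwines `Θ_g` on functionals with `conj_γ⁻¹` on `X♭`: it is `ι`-semilinear, `ι(T) = (1+T)⁻¹ − 1`.
[cite: Kobayashi2003, (7.17)–(7.21) (p. 12) and §2 p. 4] [cite: Sprung2012, Def. 7.9, Def. 7.11 (p. 1503), Prop. 7.19 (p. 1505)]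
[cite: GreenbergLNM1716, §1 p. 60 and §4 (8) p. 121] [cite: KitajimaOtsuki2018, (4.2) and Prop. 3.32] -/
theorem exists_flatLocalDualityHom (hγ : κ.IsTopGenerator γ)
    (hg : κ.IsTopGenerator (resGalOfEmb (closureEmb (K := K) (v.adicCompletion K)) g)) (hap : (p : ℤ) ∣ ap)
    {M : Type*} (J : (localTowerPointsOfEmb κ (closureEmb (K := K) (v.adicCompletion K)) W →+ ℤ_[p]) → M × IwasawaAlgebra p)
    {Js : (localTowerPointsOfEmb κ (closureEmb (K := K) (v.adicCompletion K)) W →+ ℤ_[p]) → IwasawaAlgebra p}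
    (hJ : ∀ z, IsColemanPair κ (closureEmb (K := K) (v.adicCompletion K)) W ap g c z (Js z) (J z).2)
    (D : SharpFlatSelmerDualData W κ γ (closureEmb (K := K) (v.adicCompletion K)) ap g c .flat) :
    ∃ ν : (localTowerPointsOfEmb κ (closureEmb (K := K) (v.adicCompletion K)) W →+ ℤ_[p]) →+ D.X,
      (∀ (w : localTowerPointsOfEmb κ (closureEmb (K := K) (v.adicCompletion K)) W →+ ℤ_[p])
          (s : sharpFlatSelmerInfty W κ (closureEmb (K := K) (v.adicCompletion K)) ap g c .flat)
          (φ : contOneCocycles.{0, u} (discreteTopRep κ.kerSubgroup (W.geomPrimaryTorsion p)))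
          (Q : localPoints W (v.adicCompletion K)) (k : ℕ)
          (hQ : (p ^ k) • Q ∈ localTowerPointsOfEmb κ (closureEmb (K := K) (v.adicCompletion K)) W),
          oneCocycleClass (discreteTopRep κ.kerSubgroup (W.geomPrimaryTorsion p)) φ = (s : W.subgroupH1 p κ.kerSubgroup) →
          (∀ τ : localSubgroupOfEmb κ.kerSubgroup (closureEmb (K := K) (v.adicCompletion K)),
            pointsMapOfEmb W (closureEmb (K := K) (v.adicCompletion K))
                ((φ.1 (resGalSubgroupOfEmb κ.kerSubgroup _ τ) : W.geomPrimaryTorsion p) : W.geomPoints) =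
              (τ : absoluteGaloisGroup (v.adicCompletion K)) • Q - Q) →
          ∀ a : ℤ, PadicInt.toZModPow k (w ⟨(p ^ k) • Q, hQ⟩) = (a : ZMod (p ^ k)) →
            D.toDual (ν w) s = (((a : ℚ) / (p : ℚ) ^ k : ℚ) : AddCircle (1 : ℚ))) ∧
      (∀ w, (J w).2 = 0 → ν w = 0) ∧
      (∀ (w) (s : sharpFlatSelmerInfty W κ (closureEmb (K := K) (v.adicCompletion K)) ap g c .flat),
          (s : W.subgroupH1 p κ.kerSubgroup) ∈ W.fineSelmerInfty κ → D.toDual (ν w) s = 0) ∧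
      (letI := moduleOfGenerator κ (closureEmb (K := K) (v.adicCompletion K)) W hg
        ∀ w, (1 + PowerSeries.X : IwasawaAlgebra p) • ν ((1 + PowerSeries.X : IwasawaAlgebra p) • w) = ν w) := by
  letI inst := moduleOfGenerator κ (closureEmb (K := K) (v.adicCompletion K)) W hg
  -- the pairing family and the Kummer pairing character
  obtain ⟨e, he⟩ := exists_padicPairingFamily
    (N := localTowerPointsOfEmb κ (closureEmb (K := K) (v.adicCompletion K)) W) (p := p)
  obtain ⟨Φ, hΦ⟩ := OddBlindNF.exists_kummerPairingHom (W := W) (κ := κ)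
    (ι := closureEmb (K := K) (v.adicCompletion K)) he
  have hle := sharpFlatSelmerInfty_le_localKummerOverOfEmb W κ v (ap := ap) (g := g) (c := c) .flat
  -- the character of `Sel♭` attached to `w`, and `ν` through `toDual⁻¹`
  let ν₀ : (localTowerPointsOfEmb κ (closureEmb (K := K) (v.adicCompletion K)) W →+ ℤ_[p]) →+
      (sharpFlatSelmerInfty W κ (closureEmb (K := K) (v.adicCompletion K)) ap g c .flat →+ AddCircle (1 : ℚ)) :=
    (Φ.comp (AddSubgroup.inclusion hle)).flip
  have hν₀ : ∀ w s, ν₀ w s = Φ (AddSubgroup.inclusion hle s) w := fun w s ↦ rfl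
  let ν : (localTowerPointsOfEmb κ (closureEmb (K := K) (v.adicCompletion K)) W →+ ℤ_[p]) →+ D.X :=
    D.toDualEquiv.symm.toAddMonoidHom.comp ν₀
  have hν : ∀ w, D.toDual (ν w) = ν₀ w := fun w ↦ by
    change D.toDualEquiv (D.toDualEquiv.symm (ν₀ w)) = ν₀ w
    exact AddEquiv.apply_symm_apply _ _
  -- (V) values on Kummer data
  have hV : ∀ (w : localTowerPointsOfEmb κ (closureEmb (K := K) (v.adicCompletion K)) W →+ ℤ_[p])
      (s : sharpFlatSelmerInfty W κ (closureEmb (K := K) (v.adicCompletion K)) ap g c .flat)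
      (φ : contOneCocycles.{0, u} (discreteTopRep κ.kerSubgroup (W.geomPrimaryTorsion p)))
      (Q : localPoints W (v.adicCompletion K)) (k : ℕ)
      (hQ : (p ^ k) • Q ∈ localTowerPointsOfEmb κ (closureEmb (K := K) (v.adicCompletion K)) W),
      oneCocycleClass (discreteTopRep κ.kerSubgroup (W.geomPrimaryTorsion p)) φ = (s : W.subgroupH1 p κ.kerSubgroup) →
      (∀ τ : localSubgroupOfEmb κ.kerSubgroup (closureEmb (K := K) (v.adicCompletion K)),
        pointsMapOfEmb W (closureEmb (K := K) (v.adicCompletion K))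
            ((φ.1 (resGalSubgroupOfEmb κ.kerSubgroup _ τ) : W.geomPrimaryTorsion p) : W.geomPoints) =
          (τ : absoluteGaloisGroup (v.adicCompletion K)) • Q - Q) →
      D.toDual (ν w) s = e ⟨(p ^ k) • Q, hQ⟩ k w := by
    intro w s φ Q k hQ hφ hτ
    rw [hν, hν₀, hΦ (AddSubgroup.inclusion hle s) φ Q k hQ hφ hτ]
  refine ⟨ν, fun w s φ Q k hQ hφ hτ a ha ↦ by rw [hV w s φ Q k hQ hφ hτ, he _ k w a ha], ?_, ?_, ?_⟩
  · -- (K) `Ker Col♭ ⊆ ker ν`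
    intro w hw
    have hmem : w ∈ colemanKer κ (closureEmb (K := K) (v.adicCompletion K)) W ap g c .flat :=
      (OddBlindNF.mem_colemanKer_flat_iff_snd_eq_zero hap J hJ w).mpr hw
    apply D.bijective.1
    rw [map_zero]
    ext s
    obtain ⟨φ, Q, k, hφ, hQ, hτ⟩ := hle s.2
    have hs := ((mem_sharpFlatSelmerInfty_iff W κ _ ap g c .flat (s : W.subgroupH1 p κ.kerSubgroup)).mp s.2).2 1
    rw [W.conjH1_one_holds p κ.kerSubgroup, AddMonoidHom.id_apply,
      OddBlindNF.mem_sharpFlatLocalKummerOverOfEmb_iff_forall_apply_eq_zero he _ hQ hφ hτ] at hs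
    rw [hV w s φ Q k hQ hφ hτ, AddMonoidHom.zero_apply]
    exact hs w hmem
  · -- (Z) `ν w` kills the fine Selmer group: a fine class is principal on `ker κ ⊓ D_v`
    intro w s hs
    have hs' := (mem_strictSelmerGroupOver_iff (H := κ.kerSubgroup) (M := W.geomPrimaryTorsion p)
      (L := fineData (W.geomPrimaryTorsion p) p) (s : W.subgroupH1 p κ.kerSubgroup)).1 hs
    have h0 : resOfLe (W.geomPrimaryTorsion p)
        (inf_le_left : κ.kerSubgroup ⊓ decomp (K := K) v ≤ κ.kerSubgroup) (s : W.subgroupH1 p κ.kerSubgroup) = 0 := by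
      have h1 : resOfLe (W.geomPrimaryTorsion p)
          (inf_le_left : κ.kerSubgroup ⊓ decomp (K := K) v ≤ κ.kerSubgroup)
          (W.conjH1 p κ.kerSubgroup 1 (s : W.subgroupH1 p κ.kerSubgroup)) = 0 := by
        by_cases hv : ((p : ℕ) : 𝓞 K) ∈ v.asIdeal
        · exact resOfLe_inf_decomp_eq_zero_of_mem_strictKer_fineLocalDatum W p v (hs'.2.2 v hv 1)
        · exact hs'.1 v hv 1
      rwa [W.conjH1_one_holds p κ.kerSubgroup, AddMonoidHom.id_apply] at h1
    obtain ⟨φ, hφ⟩ := oneCocycleClass_surjective _ (s : W.subgroupH1 p κ.kerSubgroup)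
    rw [← hφ] at h0
    obtain ⟨t, ht⟩ := exists_principal_of_resOfLe_eq_zero W p inf_le_left φ h0
    -- the principal class satisfies the •-condition for EVERY set of functionals, in particular `Set.univ`
    have hmem := mem_sharpFlatLocalKummerOverOfEmb_of_principal W p (resGalOfEmb_mem_decomp v) φ t
      (fun g' hg' hgD ↦ ht g' hg' (Subgroup.mem_inf.2 ⟨hg', hgD⟩))
      (localTowerPointsOfEmb κ (closureEmb (K := K) (v.adicCompletion K)) W) Set.univ
    rw [hφ] at hmem
    obtain ⟨φ', Q, k, hφ', hQ, hτ⟩ := hle s.2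
    rw [OddBlindNF.mem_sharpFlatLocalKummerOverOfEmb_iff_forall_apply_eq_zero he _ hQ hφ' hτ] at hmem
    rw [hV w s φ' Q k hQ hφ' hτ]
    exact hmem w (Set.mem_univ w)
  · -- (T) the variance `(1 + X) • ν ((1 + T) • w) = ν w`
    intro w
    apply D.bijective.1
    ext s
    -- left side: `toDual ((1+X) • x) s = toDual x (conj_γ s)`
    have hD : ∀ x : D.X, D.toDual ((1 + PowerSeries.X : IwasawaAlgebra p) • x) s =
        D.toDual x ⟨W.conjH1 p κ.kerSubgroup γ s, D.conj_mem s s.2⟩ := by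
      intro x
      rw [add_smul, one_smul, map_add, AddMonoidHom.add_apply, D.toDual_T_smul, add_sub_cancel]
    rw [hD]
    -- Kummer data of `s` and of `conj_γ s = conj_{res g} s`
    obtain ⟨φ, Q, k, hφ, hQ, hτ⟩ := hle s.2
    obtain ⟨φ', hφ', hQ', hτ'⟩ := OddBlindNF.exists_conjH1_kummerData (W := W) g hQ hτ
    rw [hφ, ← OddBlindNF.conjH1_eq_of_isTopGenerator (W := W) (p := p) hγ hg] at hφ'
    rw [hV _ ⟨W.conjH1 p κ.kerSubgroup γ s, D.conj_mem s s.2⟩ φ' (g • Q) k hQ' hφ' hτ', hV w s φ Q k hQ hφ hτ]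
    -- `((1+T) • w)(p^k g Q) = w(p^k Q)`
    refine OddBlindNF.padicPairingFamily_congr he ?_
    have hx : (⟨(p ^ k) • (g • Q), hQ'⟩ : localTowerPointsOfEmb κ (closureEmb (K := K) (v.adicCompletion K)) W) =
        ⟨g • ((⟨(p ^ k) • Q, hQ⟩ : localTowerPointsOfEmb κ (closureEmb (K := K) (v.adicCompletion K)) W) :
            localPoints W (v.adicCompletion K)),
          smul_mem_localTowerPointsOfEmb κ (closureEmb (K := K) (v.adicCompletion K)) W g hQ⟩ :=
      Subtype.ext (smul_comm _ _ _)
    rw [hx, smul_one_add_X_apply_smul_point W κ v hg]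

end SSFlatPackage

end Summit.BirchSwinnertonDyer.BirchSwinnertonDyer.Theorems

end
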